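import Mathlib.RingTheory.AdicCompletion.Basic
import Mathlib.RingTheory.Filtration
import Mathlib.RingTheory.Finiteness.Basic
import Mathlib.Algebra.BigOperators.Fin
import HarnessLib

/-!
# Generation of `t`-adically separated modules over a complete ring

Topic `Literature/RingTheory/RegularLocalRing`. The finiteness half of the algebraisation step in
Grothendieck's existence argument (SGA 2 IX §2, EGA 0_I 7.2.9): over a Noetherian ring `S`
complete for an ideal `𝔞` in the Jacobson radical and `t ∈ 𝔞`, a `t`-adically separated module
`P` with `P = S m₁ + ⋯ + S m_r + t P` is generated by `m₁, …, m_r`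
(`exists_eq_sum_smul_of_forall_add_smul`): iterate the hypothesis, sum the resulting `t`-adic
series of coefficients in `S` (they converge `𝔞`-adically, and the limit is congruent to the
partial sums modulo `t^N` because `t^N S` is closed — Krull's intersection theorem for
`S/t^N S`), and use separatedness.

Everything is proved; no named facts.

## References

* [Grothendieck1968SGA2] A. Grothendieck, SGA 2, Exp. IX §2 (théorème d'existence),
  arXiv:math/0511279, p. 58.
* [Matsumura1987] H. Matsumura, *Commutative Ring Theory*, Thm. 8.4, Thm. 8.10 (Krull).
-/

noncomputable section

universe u v

namespace Literature.RingTheory.RegularLocalRing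

open Finset

/-- **Closedness of `t^N S`**: in a Noetherian ring, if `𝔞` lies in the Jacobson radical and
`w ∈ t^N S + 𝔞^n` for every `n`, then `w ∈ t^N S` (Krull's intersection theorem for the module
`S / t^N S`). [cite: Matsumura1987, Thm. 8.10] -/
theorem mem_span_pow_of_forall_mem_sup {S : Type u} [CommRing S] [IsNoetherianRing S]
    (𝔞 : Ideal S) (h𝔞 : 𝔞 ≤ Ideal.jacobson ⊥) (t : S) (N : ℕ) (w : S)
    (hw : ∀ n : ℕ, w ∈ Ideal.span {t ^ N} ⊔ 𝔞 ^ n) : w ∈ Ideal.span {t ^ N} := by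
  set I : Ideal S := Ideal.span {t ^ N} with hI
  have hmem : (Ideal.Quotient.mk I w : S ⧸ I) ∈ (⨅ n : ℕ, 𝔞 ^ n • ⊤ : Submodule S (S ⧸ I)) := by
    refine (Submodule.mem_iInf _).mpr fun n => ?_
    obtain ⟨y, hy, z, hz, hyz⟩ := Submodule.mem_sup.mp (hw n)
    have h1 : (Ideal.Quotient.mk I w : S ⧸ I) = Ideal.Quotient.mk I z := by
      rw [← hyz, map_add, Ideal.Quotient.eq_zero_iff_mem.mpr hy, zero_add]
    rw [h1, Ideal.smul_top_eq_map, Submodule.restrictScalars_mem, Ideal.Quotient.algebraMap_eq]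
    exact Ideal.mem_map_of_mem _ hz
  rw [Ideal.iInf_pow_smul_eq_bot_of_le_jacobson 𝔞 h𝔞, Submodule.mem_bot] at hmem
  exact Ideal.Quotient.eq_zero_iff_mem.mp hmem

/-- **`t`-adic limits in an `𝔞`-adically complete Noetherian ring** (`t ∈ 𝔞 ⊆` Jacobson
radical): every sequence of coefficients `c_k` has a "sum" `a = Σ t^k c_k`, i.e. an element with
`a - Σ_{k<N} t^k c_k ∈ t^N S` for all `N`. [cite: Matsumura1987, Thm. 8.4 and Thm. 8.10] -/
theorem exists_forall_sub_sum_mem_span_pow {S : Type u} [CommRing S] [IsNoetherianRing S]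
    (𝔞 : Ideal S) [IsPrecomplete 𝔞 S] (h𝔞 : 𝔞 ≤ Ideal.jacobson ⊥) {t : S} (ht : t ∈ 𝔞)
    (c : ℕ → S) : ∃ a : S, ∀ N : ℕ, a - ∑ k ∈ range N, t ^ k * c k ∈ Ideal.span {t ^ N} := by
  set f : ℕ → S := fun N => ∑ k ∈ range N, t ^ k * c k with hf
  -- partial sums differ by multiples of `t^m`
  have hdiff : ∀ m n : ℕ, m ≤ n → f n - f m ∈ Ideal.span {t ^ m} := by
    intro m n hmn
    rw [hf]
    simp only
    rw [← sum_range_add_sum_Ico _ hmn, add_sub_cancel_left]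
    refine Ideal.sum_mem _ fun k hk => ?_
    have hmk : m ≤ k := (mem_Ico.mp hk).1
    obtain ⟨j, rfl⟩ := Nat.exists_eq_add_of_le hmk
    rw [pow_add, mul_assoc]
    exact Ideal.mul_mem_right _ _ (Ideal.mem_span_singleton_self _)
  have hcauchy : ∀ {m n : ℕ}, m ≤ n → f m ≡ f n [SMOD (𝔞 ^ m • ⊤ : Submodule S S)] := by
    intro m n hmn
    rw [SModEq.sub_mem, smul_eq_mul, Ideal.mul_top]
    have h1 : f m - f n = -(f n - f m) := by ring
    rw [h1]
    refine Submodule.neg_mem _ (Ideal.pow_le_pow_right le_rfl ?_)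
    have h2 : Ideal.span {t ^ m} ≤ 𝔞 ^ m := by
      rw [Ideal.span_singleton_le_iff_mem]; exact Ideal.pow_mem_pow ht m
    exact h2 (hdiff m n hmn)
  obtain ⟨a, ha⟩ := IsPrecomplete.prec (inferInstance : IsPrecomplete 𝔞 S) hcauchy
  refine ⟨a, fun N => mem_span_pow_of_forall_mem_sup 𝔞 h𝔞 t N _ fun n => ?_⟩
  -- `a - f N = (a - f M) + (f M - f N)` with `M = max n N`
  set M := max n N with hM
  have h1 : a - f M ∈ 𝔞 ^ n := by
    have h2 := ha M
    rw [SModEq.sub_mem, smul_eq_mul, Ideal.mul_top] at h2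
    have h3 : a - f M = -(f M - a) := by ring
    rw [h3]
    exact Submodule.neg_mem _ (Ideal.pow_le_pow_right (le_max_left n N) h2)
  have h4 : a - f N = (f M - f N) + (a - f M) := by ring
  rw [h4]
  exact Submodule.add_mem_sup (hdiff N M (le_max_right n N)) h1

/-- **Generation of a `t`-adically separated module over a complete ring.** Let `S` be
Noetherian and `𝔞`-adically (pre)complete with `𝔞` in the Jacobson radical, `t ∈ 𝔞`, and let
`P` be an `S`-module in which an element divisible by every power of `t` is zero. If
`m₁, …, m_r ∈ P` satisfy `P = Σ S mᵢ + t P`, then they generate `P`.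
[cite: Grothendieck1968SGA2, Exp. IX §2] -/
theorem exists_eq_sum_smul_of_forall_add_smul {S : Type u} [CommRing S] [IsNoetherianRing S]
    (𝔞 : Ideal S) [IsPrecomplete 𝔞 S] (h𝔞 : 𝔞 ≤ Ideal.jacobson ⊥) {t : S} (ht : t ∈ 𝔞)
    {P : Type v} [AddCommGroup P] [Module S P]
    (hsep : ∀ x : P, (∀ N : ℕ, ∃ y : P, x = t ^ N • y) → x = 0)
    {r : ℕ} (m : Fin r → P)
    (hgen : ∀ x : P, ∃ (c : Fin r → S) (x' : P), x = ∑ i, c i • m i + t • x') (x : P) :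
    ∃ a : Fin r → S, x = ∑ i, a i • m i := by
  choose C T hCT using hgen
  -- the iteration `x₀ = x`, `x_{k+1} = T x_k`
  set xs : ℕ → P := fun k => Nat.rec x (fun _ y => T y) k with hxs
  have hxs0 : xs 0 = x := rfl
  have hxs_succ : ∀ k, xs (k + 1) = T (xs k) := fun k => rfl
  -- partial sums of coefficients
  have hpartial : ∀ N : ℕ, x = ∑ i, (∑ k ∈ range N, t ^ k * C (xs k) i) • m i + t ^ N • xs N := by
    intro N
    induction N with
    | zero => simp [hxs0]
    | succ N ih =>
      have hstep : t ^ N • xs N = ∑ i, (t ^ N * C (xs N) i) • m i + t ^ (N + 1) • xs (N + 1) := by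
        rw [hxs_succ, pow_succ, mul_smul]
        conv_lhs => rw [hCT (xs N)]
        rw [smul_add, smul_sum]
        congr 1
        exact sum_congr rfl fun i _ => by rw [smul_smul]
      conv_lhs => rw [ih]
      rw [hstep, ← add_assoc, ← sum_add_distrib]
      congr 1
      refine sum_congr rfl fun i _ => ?_
      rw [sum_range_succ, add_smul]
  -- sum the coefficient series
  have hlim := fun i => exists_forall_sub_sum_mem_span_pow 𝔞 h𝔞 ht (fun k => C (xs k) i)
  choose a ha using hlim
  refine ⟨a, ?_⟩
  -- `x - Σ aᵢ mᵢ` is divisible by every `t^N`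
  have hdiv : ∀ N : ℕ, ∃ y : P, (x - ∑ i, a i • m i) = t ^ N • y := by
    intro N
    have hb : ∀ i, ∃ b : S, a i - ∑ k ∈ range N, t ^ k * C (xs k) i = t ^ N * b := fun i =>
      Ideal.mem_span_singleton'.mp (ha i N) |>.imp fun b hb => by rw [← hb, mul_comm]
    choose b hb using hb
    refine ⟨xs N - ∑ i, b i • m i, ?_⟩
    conv_lhs => rw [hpartial N]
    have h1 : ∀ i, a i • m i = (∑ k ∈ range N, t ^ k * C (xs k) i) • m i + (t ^ N * b i) • m i :=
      fun i => by rw [← add_smul, ← hb i, add_sub_cancel]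
    simp only [h1, sum_add_distrib, smul_sub, smul_sum, mul_smul]
    abel
  have h0 := hsep _ hdiv
  exact sub_eq_zero.mp h0

end Literature.RingTheory.RegularLocalRing

end
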